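import Literature.Geometry.GeometricMeasureTheory.Currents
import Mathlib.MeasureTheory.Covering.Vitali
import Mathlib.MeasureTheory.Measure.Regular

/-!
# Upper densities and Hausdorff measure: Federer 2.10.19 (3), (4)

For a measure `μ` on a (second countable) real normed space `V` and the `m`-dimensional upper
density `Θ^{*m}(μ, x) = limsup_{r → 0+} μ 𝐁(x,r) / (α(m) rᵐ)` of
`Literature.Geometry.GeometricMeasureTheory.Currents` (`upperDensity`):

* `mul_hausdorffMeasure_le_of_lt_upperDensity` — **density comparison** (Federer 2.10.19 (3),
  "if V is open, B ⊂ V and Θ^{*m}(μ, x) > t whenever x ∈ B, then μ(V) ≥ t 𝓢^m(B)"), here with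
  Mathlib's unnormalised Hausdorff measure `μH[m]` and the weaker constant of the `5r`-covering
  argument: `t · α(m) · μH[m](B) ≤ 8ᵐ · μ(V)`.
* `hausdorffMeasure_null_setOf_upperDensity_pos`, `ae_restrict_upperDensity_eq_zero` — the
  consequence (Federer 2.10.19 (4), "Θ^m(μ ⌞ A, x) = 0 for 𝓢^m almost all x in X ∼ A"): on a
  `μ`-null set `B` (`μ` outer regular) the upper density of `μ` vanishes `𝓗^m`-almost everywhere.
* `measure_le_of_upperDensity_lt` — Federer 2.10.19 (1): `Θ^{*m}(μ, ·) < t` on `A` implies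
  `μ(A) ≤ t α(m) μH[m](A)` (any measure `μ`, any set `A`; straight from the definition of
  Hausdorff measure, `OuterMeasure.le_mkMetric`); `hausdorffMeasure_null_setOf_upperDensity_lt`,
  `ae_le_upperDensity_hausdorffMeasure_restrict` — the lower density bound 2.10.19 (2):
  `Θ^{*m}(μH[m] ⌞ A, x) ≥ α(m)⁻¹` for `μH[m]`-a.e. `x ∈ A` when `μH[m](A) < ∞`.
* `upperDensity_mono`, `upperDensity_add_eq_left_of_eq_zero`,
  `approxTangentCone_add_eq_of_upperDensity_eq_zero` — monotonicity of `Θ^{*m}` in the measure,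
  `Θ^{*m}(μ + ν) = Θ^{*m}(μ)` and `Tan^m(μ + ν, ·) = Tan^m(μ, ·)` where `Θ^{*m}(ν, ·) = 0`
  [3.2.16]; hence `ae_approxTangentCone_union_eq`: for measurable `W₁, W₂` with `𝓗^m ⌞ W₂`
  locally finite, `Tan^m(𝓗^m ⌞ (W₁ ∪ W₂), x) = Tan^m(𝓗^m ⌞ W₁, x)` for `𝓗^m`-a.e. `x ∈ W₁`
  (the step that makes sums of rectifiable currents rectifiable, cf. 4.1.28).

Source: H. Federer, *Geometric Measure Theory*, Springer 1969 (`Federer1969`), 2.10.18–2.10.19,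
3.2.16 (held copy `lit book:federernd-geometric-measure-theory`, PDF pp. 158–159, 216). The
covering argument used here is the `5r`-lemma (Mathlib's `Vitali`) instead of Federer's 2.8.6,
whence the constant `8ᵐ` in place of the sharp one.
-/

open scoped ENNReal NNReal Topology
open MeasureTheory MeasureTheory.Measure TopologicalSpace Set Filter Metric

namespace Literature.Geometry.GeometricMeasureTheory

variable {V : Type*} [NormedAddCommGroup V] [NormedSpace ℝ V] [MeasurableSpace V] [BorelSpace V]
  {m : ℕ}

/-! ### The constants `α(m)` -/

omit [MeasurableSpace V] [BorelSpace V] in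
/-- `α(m) > 0`. [cite: Federer1969, 2.7.16 (1)] -/
theorem unitBallVolume_ne_zero (m : ℕ) : unitBallVolume m ≠ 0 :=
  (Metric.measure_ball_pos volume (0 : EuclideanSpace ℝ (Fin m)) one_pos).ne'

omit [MeasurableSpace V] [BorelSpace V] in
/-- `α(m) < ∞`. [cite: Federer1969, 2.7.16 (1)] -/
theorem unitBallVolume_ne_top (m : ℕ) : unitBallVolume m ≠ ∞ :=
  measure_ball_lt_top.ne

/-! ### Monotonicity and additivity of upper densities -/

omit [NormedSpace ℝ V] [BorelSpace V] in
/-- `Θ^{*m}(μ, a) ≤ Θ^{*m}(ν, a)` when `μ ≤ ν`. [cite: Federer1969, 2.10.19] -/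
theorem upperDensity_mono {μ ν : Measure V} (h : μ ≤ ν) (a : V) :
    upperDensity m μ a ≤ upperDensity m ν a :=
  limsup_le_limsup (Eventually.of_forall fun r => by
    dsimp only
    gcongr)

omit [NormedSpace ℝ V] [BorelSpace V] in
/-- `Θ^{*m}(μ, a) = 0` forces `μ 𝐁(a,r) / (α(m) rᵐ) → 0` as `r → 0+`. [cite: Federer1969, 2.10.19] -/
theorem tendsto_of_upperDensity_eq_zero {μ : Measure V} {a : V} (h : upperDensity m μ a = 0) :
    Tendsto (fun r : ℝ => μ (closedBall a r) / (unitBallVolume m * ENNReal.ofReal (r ^ m)))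
      (𝓝[>] (0 : ℝ)) (𝓝 0) := by
  refine ENNReal.tendsto_nhds_zero.2 fun ε hε => ?_
  have h' : limsup (fun r : ℝ => μ (closedBall a r) / (unitBallVolume m * ENNReal.ofReal (r ^ m)))
      (𝓝[>] (0 : ℝ)) < ε := by
    rw [show limsup _ _ = upperDensity m μ a from rfl, h]
    exact hε
  exact (eventually_lt_of_limsup_lt h').mono fun r hr => hr.le

omit [NormedSpace ℝ V] [BorelSpace V] in
/-- **`Θ^{*m}(μ + ν, a) = Θ^{*m}(μ, a)` when `Θ^{*m}(ν, a) = 0`.** [cite: Federer1969, 2.10.19] -/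
theorem upperDensity_add_eq_left_of_eq_zero (μ ν : Measure V) {a : V}
    (h : upperDensity m ν a = 0) : upperDensity m (μ + ν) a = upperDensity m μ a := by
  unfold upperDensity
  have : (fun r : ℝ => (μ + ν) (closedBall a r) / (unitBallVolume m * ENNReal.ofReal (r ^ m))) =
      (fun r : ℝ => μ (closedBall a r) / (unitBallVolume m * ENNReal.ofReal (r ^ m))) +
        fun r : ℝ => ν (closedBall a r) / (unitBallVolume m * ENNReal.ofReal (r ^ m)) := by
    funext r
    simp only [Measure.add_apply, Pi.add_apply, ENNReal.add_div]
  rw [this, ENNReal.limsup_add_of_right_tendsto_zero (tendsto_of_upperDensity_eq_zero h)]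

omit [BorelSpace V] in
/-- **`Tan^m(μ + ν, a) = Tan^m(μ, a)` when `Θ^{*m}(ν, a) = 0`**: the sets `S` with
`Θ^{*m}((μ + ν) ⌞ Sᶜ, a) = 0` and with `Θ^{*m}(μ ⌞ Sᶜ, a) = 0` coincide, because
`Θ^{*m}(ν ⌞ Sᶜ, a) ≤ Θ^{*m}(ν, a) = 0`. [cite: Federer1969, 3.2.16] -/
theorem approxTangentCone_add_eq_of_upperDensity_eq_zero (μ ν : Measure V) {a : V}
    (h : upperDensity m ν a = 0) : approxTangentCone m (μ + ν) a = approxTangentCone m μ a := by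
  have key : ∀ S : Set V, upperDensity m ((μ + ν).restrict Sᶜ) a = upperDensity m (μ.restrict Sᶜ) a := by
    intro S
    rw [Measure.restrict_add]
    refine upperDensity_add_eq_left_of_eq_zero _ _ (le_antisymm ?_ bot_le)
    exact (upperDensity_mono Measure.restrict_le_self a).trans h.le
  ext v
  simp only [approxTangentCone, mem_iInter, key]

/-! ### Density comparison with Hausdorff measure (Federer 2.10.19 (3)) -/

omit [NormedSpace ℝ V] [MeasurableSpace V] [BorelSpace V] in
/-- The diameter of a closed ball of radius `r` is at most `2r`. [folklore] -/
theorem ediam_closedBall_le_two_mul (x : V) (r : ℝ) :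
    Metric.ediam (closedBall x r) ≤ ENNReal.ofReal (2 * r) := by
  refine Metric.ediam_le fun y hy z hz => ?_
  rw [edist_dist]
  apply ENNReal.ofReal_le_ofReal
  calc dist y z ≤ dist y x + dist z x := dist_triangle_right _ _ _
    _ ≤ r + r := add_le_add (mem_closedBall.1 hy) (mem_closedBall.1 hz)
    _ = 2 * r := by ring

/-- **Density comparison** (weak-constant form of Federer 2.10.19 (3)): if `U` is open, `B ⊆ U`
and `Θ^{*m}(μ, x) > t` for every `x ∈ B`, then `t · α(m) · μH[m](B) ≤ 8ᵐ · μ(U)`. Proof: for every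
`δ > 0` the closed balls `𝐁(x, r) ⊆ U`, `x ∈ B`, `r ≤ δ`, with `μ 𝐁(x,r) > t α(m) rᵐ` cover `B`;
a disjoint Vitali subfamily `{𝐁(xᵢ, rᵢ)}` has `B ⊆ ⋃ 𝐁(xᵢ, 4rᵢ)`, so
`μH[m]_{8δ}(B) ≤ Σ (8rᵢ)ᵐ ≤ 8ᵐ (t α(m))⁻¹ Σ μ 𝐁(xᵢ, rᵢ) ≤ 8ᵐ (t α(m))⁻¹ μ(U)`.
[cite: Federer1969, 2.10.19 (3) (with 2.10.18 (1); constant weakened)] -/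
theorem mul_hausdorffMeasure_le_of_lt_upperDensity [SecondCountableTopology V] (μ : Measure V)
    (m : ℕ) {t : ℝ≥0∞} {B U : Set V} (hU : IsOpen U) (hBU : B ⊆ U)
    (hB : ∀ x ∈ B, t < upperDensity m μ x) :
    t * unitBallVolume m * μH[m] B ≤ 8 ^ m * μ U := by
  -- trivial cases `t = 0`, `t = ∞` (then `B = ∅`), `μ U = ∞`
  rcases eq_or_ne t 0 with rfl | ht0
  · simp
  rcases eq_or_ne t ⊤ with rfl | httop
  · have hBe : B = ∅ := eq_empty_iff_forall_notMem.2 fun x hx => not_top_lt (hB x hx)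
    simp [hBe]
  rcases eq_or_ne (μ U) ⊤ with hμU | hμU
  · rw [hμU, ENNReal.mul_top (pow_ne_zero _ (by norm_num))]
    exact le_top
  have hα0 : unitBallVolume m ≠ 0 := unitBallVolume_ne_zero m
  have hαtop : unitBallVolume m ≠ ⊤ := unitBallVolume_ne_top m
  have htα0 : t * unitBallVolume m ≠ 0 := mul_ne_zero ht0 hα0
  have htαtop : t * unitBallVolume m ≠ ⊤ := ENNReal.mul_ne_top httop hαtop
  -- Step 1: the fine cover
  have hcover : ∀ δ : ℝ, 0 < δ → ∀ x ∈ B, ∃ r : ℝ, 0 < r ∧ r ≤ δ ∧ closedBall x r ⊆ U ∧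
      t * (unitBallVolume m * ENNReal.ofReal (r ^ m)) < μ (closedBall x r) := by
    intro δ hδ x hx
    have h1 : ∃ᶠ r in 𝓝[>] (0 : ℝ),
        t < μ (closedBall x r) / (unitBallVolume m * ENNReal.ofReal (r ^ m)) :=
      frequently_lt_of_lt_limsup (by isBoundedDefault) (hB x hx)
    obtain ⟨ε, hε, hεU⟩ := Metric.nhds_basis_closedBall.mem_iff.1 (hU.mem_nhds (hBU hx))
    have h2 : ∀ᶠ r in 𝓝[>] (0 : ℝ), 0 < r ∧ r ≤ δ ∧ closedBall x r ⊆ U := by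
      filter_upwards [Ioo_mem_nhdsGT (lt_min hδ hε)] with r hr
      exact ⟨hr.1, (hr.2.trans_le (min_le_left _ _)).le,
        (closedBall_subset_closedBall (hr.2.trans_le (min_le_right _ _)).le).trans hεU⟩
    obtain ⟨r, hr1, hr2, hr3, hr4⟩ := (h1.and_eventually h2).exists
    refine ⟨r, hr2, hr3, hr4, ?_⟩
    have hb0 : unitBallVolume m * ENNReal.ofReal (r ^ m) ≠ 0 :=
      mul_ne_zero hα0 (ENNReal.ofReal_pos.2 (pow_pos hr2 m)).ne'
    have hbtop : unitBallVolume m * ENNReal.ofReal (r ^ m) ≠ ⊤ :=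
      ENNReal.mul_ne_top hαtop ENNReal.ofReal_ne_top
    exact (ENNReal.lt_div_iff_mul_lt (Or.inl hb0) (Or.inl hbtop)).1 hr1
  -- Step 2: Vitali subfamilies at scales `δ n = 1 / (n + 1)`
  set δ : ℕ → ℝ := fun n => 1 / ((n : ℝ) + 1) with hδ
  have hδpos : ∀ n, 0 < δ n := fun n => by rw [hδ]; positivity
  let Tn : ℕ → Set (V × ℝ) := fun n => {p | p.1 ∈ B ∧ 0 < p.2 ∧ p.2 ≤ δ n ∧
    closedBall p.1 p.2 ⊆ U ∧ t * (unitBallVolume m * ENNReal.ofReal (p.2 ^ m)) < μ (closedBall p.1 p.2)}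
  have hVit : ∀ n, ∃ u ⊆ Tn n, (u.PairwiseDisjoint fun p => closedBall p.1 p.2) ∧
      ∀ a ∈ Tn n, ∃ b ∈ u, closedBall a.1 a.2 ⊆ closedBall b.1 (4 * b.2) := fun n =>
    Vitali.exists_disjoint_subfamily_covering_enlargement_closedBall (Tn n) Prod.fst Prod.snd (δ n)
      (fun a ha => ha.2.2.1) 4 (by norm_num)
  choose u huT hudisj hucov using hVit
  have hucount : ∀ n, (u n).Countable := fun n =>
    (hudisj n).countable_of_nonempty_interior fun p hp => by
      rw [interior_closedBall p.1 (huT n hp).2.1.ne']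
      exact nonempty_ball.2 (huT n hp).2.1
  haveI : ∀ n, Countable ↥(u n) := fun n => (hucount n).to_subtype
  -- Step 3: `B ⊆ ⋃_{p ∈ u n} 𝐁(p.1, 4 p.2)`
  have hBcov : ∀ n, B ⊆ ⋃ p : ↥(u n), closedBall p.1.1 (4 * p.1.2) := by
    intro n x hx
    obtain ⟨r, hr1, hr2, hr3, hr4⟩ := hcover (δ n) (hδpos n) x hx
    obtain ⟨b, hb, hxb⟩ := hucov n (x, r) ⟨hx, hr1, hr2, hr3, hr4⟩
    exact mem_iUnion.2 ⟨⟨b, hb⟩, hxb (mem_closedBall_self hr1.le)⟩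
  -- Step 4: the Hausdorff measure bound by these covers
  have hH : μH[m] B ≤ liminf (fun n => ∑' p : ↥(u n),
      Metric.ediam (closedBall p.1.1 (4 * p.1.2)) ^ (m : ℝ)) atTop := by
    refine hausdorffMeasure_le_liminf_tsum (m : ℝ) B (fun n => ENNReal.ofReal (8 * δ n)) ?_
      (fun n (p : ↥(u n)) => closedBall p.1.1 (4 * p.1.2)) (Eventually.of_forall fun n p => ?_)
      (Eventually.of_forall hBcov)
    · have h0 : Tendsto (fun n : ℕ => 8 * δ n) atTop (𝓝 0) := by
        have h := (tendsto_one_div_add_atTop_nhds_zero_nat).const_mul (8 : ℝ)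
        rw [mul_zero] at h
        exact h
      simpa using ENNReal.tendsto_ofReal h0
    · refine (ediam_closedBall_le_two_mul _ _).trans ?_
      apply ENNReal.ofReal_le_ofReal
      linarith [(huT n p.2).2.2.1]
  -- Step 5: each sum is at most `8^m μ(U) / (t α(m))`
  have hsum : ∀ n, ∑' p : ↥(u n), Metric.ediam (closedBall p.1.1 (4 * p.1.2)) ^ (m : ℝ) ≤
      8 ^ m * (μ U / (t * unitBallVolume m)) := by
    intro n
    have h1 : ∀ p : ↥(u n), Metric.ediam (closedBall p.1.1 (4 * p.1.2)) ^ (m : ℝ) ≤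
        8 ^ m * ENNReal.ofReal (p.1.2 ^ m) := by
      intro p
      have hr0 : 0 < p.1.2 := (huT n p.2).2.1
      calc Metric.ediam (closedBall p.1.1 (4 * p.1.2)) ^ (m : ℝ)
          ≤ ENNReal.ofReal (2 * (4 * p.1.2)) ^ (m : ℝ) := by
            gcongr
            exact ediam_closedBall_le_two_mul _ _
        _ = 8 ^ m * ENNReal.ofReal (p.1.2 ^ m) := by
            rw [ENNReal.rpow_natCast, ← ENNReal.ofReal_pow (by linarith), show 2 * (4 * p.1.2) =
              8 * p.1.2 by ring, mul_pow, ENNReal.ofReal_mul (by positivity),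
              ENNReal.ofReal_pow (by norm_num)]
            norm_num
    have h2 : ∀ p : ↥(u n), ENNReal.ofReal (p.1.2 ^ m) ≤
        μ (closedBall p.1.1 p.1.2) / (t * unitBallVolume m) := by
      intro p
      refine (ENNReal.le_div_iff_mul_le (Or.inl htα0) (Or.inl htαtop)).2 ?_
      have := (huT n p.2).2.2.2.2
      calc ENNReal.ofReal (p.1.2 ^ m) * (t * unitBallVolume m)
          = t * (unitBallVolume m * ENNReal.ofReal (p.1.2 ^ m)) := by ring
        _ ≤ μ (closedBall p.1.1 p.1.2) := this.le
    have h3 : ∑' p : ↥(u n), μ (closedBall p.1.1 p.1.2) ≤ μ U := by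
      refine (tsum_meas_le_meas_iUnion_of_disjoint μ
        (fun p => isClosed_closedBall.measurableSet) fun p q hpq => ?_).trans (measure_mono ?_)
      · exact hudisj n p.2 q.2 fun h => hpq (Subtype.ext h)
      · exact iUnion_subset fun p => (huT n p.2).2.2.2.1
    calc ∑' p : ↥(u n), Metric.ediam (closedBall p.1.1 (4 * p.1.2)) ^ (m : ℝ)
        ≤ ∑' p : ↥(u n), 8 ^ m * (μ (closedBall p.1.1 p.1.2) / (t * unitBallVolume m)) :=
          ENNReal.tsum_le_tsum fun p => (h1 p).trans (by gcongr; exact h2 p)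
      _ = 8 ^ m * ((∑' p : ↥(u n), μ (closedBall p.1.1 p.1.2)) / (t * unitBallVolume m)) := by
          rw [ENNReal.tsum_mul_left]
          simp only [div_eq_mul_inv, ENNReal.tsum_mul_right]
      _ ≤ 8 ^ m * (μ U / (t * unitBallVolume m)) := by gcongr
  -- Step 6: conclude
  have hH' : μH[m] B ≤ 8 ^ m * (μ U / (t * unitBallVolume m)) :=
    hH.trans (liminf_le_of_frequently_le' (Frequently.of_forall hsum))
  calc t * unitBallVolume m * μH[m] B
      ≤ t * unitBallVolume m * (8 ^ m * (μ U / (t * unitBallVolume m))) := by gcongr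
    _ = 8 ^ m * μ U := by
        rw [mul_comm (8 ^ m : ℝ≥0∞), ← mul_assoc, ENNReal.mul_div_cancel htα0 htαtop, mul_comm]

/-! ### Vanishing of the upper density off the carrier (Federer 2.10.19 (4)) -/

/-- On a `μ`-null set, `Θ^{*m}(μ, ·) = 0` outside an `𝓗^m`-null set (`μ` outer regular): for
`t > 0` the set `B_t = {x ∈ B : Θ^{*m}(μ, x) > t}` satisfies `t α(m) μH[m](B_t) ≤ 8ᵐ μ(U)` for
every open `U ⊇ B_t`, and `inf μ(U) = μ(B_t) = 0`. [cite: Federer1969, 2.10.19 (4)] -/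
theorem hausdorffMeasure_null_setOf_upperDensity_pos [SecondCountableTopology V] (μ : Measure V)
    [μ.OuterRegular] (m : ℕ) {B : Set V} (hB : μ B = 0) :
    μH[m] {x ∈ B | 0 < upperDensity m μ x} = 0 := by
  have key : ∀ n : ℕ, μH[m] {x ∈ B | ((n : ℝ≥0∞))⁻¹ < upperDensity m μ x} = 0 := by
    intro n
    set Bn := {x ∈ B | ((n : ℝ≥0∞))⁻¹ < upperDensity m μ x} with hBn
    have hBn0 : μ Bn = 0 := measure_mono_null (fun x hx => hx.1) hB
    have ht0 : ((n : ℝ≥0∞))⁻¹ * unitBallVolume m ≠ 0 :=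
      mul_ne_zero (ENNReal.inv_ne_zero.2 (ENNReal.natCast_ne_top n)) (unitBallVolume_ne_zero m)
    -- `t α μH(Bn) / 8^m ≤ μ U` for all open `U ⊇ Bn`, hence `≤ μ Bn = 0`
    have h1 : ((n : ℝ≥0∞))⁻¹ * unitBallVolume m * μH[m] Bn / 8 ^ m ≤ μ Bn := by
      rw [Set.measure_eq_iInf_isOpen Bn μ]
      refine le_iInf₂ fun U hU => le_iInf fun hUo => ?_
      refine (ENNReal.div_le_iff_le_mul (Or.inl (pow_ne_zero _ (by norm_num)))
        (Or.inl (ENNReal.pow_ne_top (by norm_num)))).2 ?_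
      rw [mul_comm (μ U)]
      exact mul_hausdorffMeasure_le_of_lt_upperDensity μ m hUo hU fun x hx => hx.2
    rw [hBn0, nonpos_iff_eq_zero, ENNReal.div_eq_zero_iff] at h1
    rcases h1 with h1 | h1
    · exact (mul_eq_zero.1 h1).resolve_left ht0
    · exact absurd h1 (ENNReal.pow_ne_top (by norm_num))
  have hsub : {x ∈ B | 0 < upperDensity m μ x} ⊆ ⋃ n : ℕ, {x ∈ B | ((n : ℝ≥0∞))⁻¹ < upperDensity m μ x} := by
    intro x hx
    obtain ⟨n, hn⟩ := ENNReal.exists_inv_nat_lt hx.2.ne'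
    exact mem_iUnion.2 ⟨n, hx.1, hn⟩
  exact measure_mono_null hsub (measure_iUnion_null key)

/-- The same for the Euclidean-normalised Hausdorff measure `μHE[m] = c • μH[m]`.
[cite: Federer1969, 2.10.19 (4)] -/
theorem euclideanHausdorffMeasure_null_setOf_upperDensity_pos [SecondCountableTopology V]
    (μ : Measure V) [μ.OuterRegular] (m : ℕ) {B : Set V} (hB : μ B = 0) :
    (μHE[m] : Measure V) {x ∈ B | 0 < upperDensity m μ x} = 0 := by
  rw [euclideanHausdorffMeasure_def, Measure.smul_apply,
    hausdorffMeasure_null_setOf_upperDensity_pos μ m hB, smul_zero]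

/-- **Federer 2.10.19 (4), a.e. form**: if `μ(B) = 0` (`μ` outer regular, `B` measurable) then
`Θ^{*m}(μ, x) = 0` for `𝓗^m`-almost every `x ∈ B`. [cite: Federer1969, 2.10.19 (4)] -/
theorem ae_restrict_upperDensity_eq_zero [SecondCountableTopology V] (μ : Measure V)
    [μ.OuterRegular] (m : ℕ) {B : Set V} (hBm : MeasurableSet B) (hB : μ B = 0) :
    ∀ᵐ x ∂((μHE[m] : Measure V).restrict B), upperDensity m μ x = 0 := by
  rw [ae_restrict_iff' hBm, ae_iff]
  have : {x | ¬(x ∈ B → upperDensity m μ x = 0)} = {x ∈ B | 0 < upperDensity m μ x} := by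
    ext x
    simp [pos_iff_ne_zero]
  rw [this]
  exact euclideanHausdorffMeasure_null_setOf_upperDensity_pos μ m hB

/-! ### Approximate tangent cones of a union (towards additivity of `𝓡_m`) -/

/-- **Approximate tangent cones ignore the other sheet**: for measurable `W₁, W₂ ⊆ V` with
`𝓗^m ⌞ W₂` locally finite, `Tan^m(𝓗^m ⌞ (W₁ ∪ W₂), x) = Tan^m(𝓗^m ⌞ W₁, x)` for `𝓗^m`-almost every
`x ∈ W₁` (because `Θ^{*m}(𝓗^m ⌞ (W₂ ∖ W₁), x) = 0` there, 2.10.19 (4)).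
[cite: Federer1969, 2.10.19 (4) and 3.2.16] -/
theorem ae_approxTangentCone_union_eq [SecondCountableTopology V] [SigmaCompactSpace V]
    {W₁ W₂ : Set V} (hW₁ : MeasurableSet W₁) (hW₂ : MeasurableSet W₂)
    [IsLocallyFiniteMeasure ((μHE[m] : Measure V).restrict W₂)] :
    ∀ᵐ x ∂((μHE[m] : Measure V).restrict W₁),
      approxTangentCone m ((μHE[m] : Measure V).restrict (W₁ ∪ W₂)) x =
        approxTangentCone m ((μHE[m] : Measure V).restrict W₁) x := by
  set ν : Measure V := (μHE[m] : Measure V).restrict (W₂ \ W₁) with hν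
  haveI : IsLocallyFiniteMeasure ν :=
    Measure.isLocallyFiniteMeasure_of_le (Measure.restrict_mono Set.sdiff_subset le_rfl)
  have hνW₁ : ν W₁ = 0 := by
    rw [hν, Measure.restrict_apply hW₁]
    simp
  have hsplit : (μHE[m] : Measure V).restrict (W₁ ∪ W₂) =
      (μHE[m] : Measure V).restrict W₁ + ν := by
    rw [hν, ← Measure.restrict_union disjoint_sdiff_right (hW₂.diff hW₁), Set.union_sdiff_self]
  filter_upwards [ae_restrict_upperDensity_eq_zero ν m hW₁ hνW₁] with x hx
  rw [hsplit]
  exact approxTangentCone_add_eq_of_upperDensity_eq_zero _ _ hx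

/-! ### Mass bounds from upper densities (Federer 2.10.19 (1), (2)) -/

omit [NormedSpace ℝ V] in
/-- **Federer 2.10.19 (1)**: if `Θ^{*m}(μ, x) < t` for all `x ∈ A` then
`μ(A) ≤ t · α(m) · μH[m](A)` (`= 2ᵐ t 𝓗^m(A)` for the normalised Hausdorff measure), for an
arbitrary measure `μ` and an arbitrary set `A`: on the pieces
`Aₙ = {x ∈ A : μ 𝐁(x,r) ≤ t α(m) rᵐ for 0 < r < 1/(n+1)}` every set `S` of small diameter meeting
`Aₙ` at `x` lies in `𝐁(x, diam S)`, so `(t α(m))⁻¹ μ ⌞ Aₙ ≤ μH[m]` by the definition of Hausdorff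
measure (`le_mkMetric`), and `Aₙ ↑ A`. [cite: Federer1969, 2.10.19 (1) (with 2.10.17 (2))] -/
theorem measure_le_of_upperDensity_lt (μ : Measure V) (m : ℕ) {t : ℝ≥0∞} {A : Set V}
    (hA : ∀ x ∈ A, upperDensity m μ x < t) :
    μ A ≤ t * unitBallVolume m * μH[m] A := by
  have hα0 : unitBallVolume m ≠ 0 := unitBallVolume_ne_zero m
  have hαtop : unitBallVolume m ≠ ⊤ := unitBallVolume_ne_top m
  -- reduce to `t < ⊤`
  wlog httop : t ≠ ⊤ generalizing t A
  · rw [not_ne_iff] at httop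
    subst httop
    rcases eq_or_ne (μH[m] A) 0 with hH | hH
    · -- `A = ⋃ₖ {Θ* < k}`, each piece `μ`-null
      have hcov : A ⊆ ⋃ k : ℕ, {x ∈ A | upperDensity m μ x < k} := fun x hx => by
        obtain ⟨k, hk⟩ := ENNReal.exists_nat_gt (hA x hx).ne
        exact mem_iUnion.2 ⟨k, hx, hk⟩
      have hk : ∀ k : ℕ, μ {x ∈ A | upperDensity m μ x < k} = 0 := by
        intro k
        refine le_antisymm ?_ bot_le
        calc μ {x ∈ A | upperDensity m μ x < k}
            ≤ k * unitBallVolume m * μH[m] {x ∈ A | upperDensity m μ x < k} :=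
              this (fun x hx => hx.2) (ENNReal.natCast_ne_top k)
          _ ≤ k * unitBallVolume m * μH[m] A := by gcongr; exact fun x hx => hx.1
          _ = 0 := by rw [hH, mul_zero]
      calc μ A ≤ μ (⋃ k : ℕ, {x ∈ A | upperDensity m μ x < k}) := measure_mono hcov
        _ ≤ ∑' k : ℕ, μ {x ∈ A | upperDensity m μ x < k} := measure_iUnion_le _
        _ = 0 := ENNReal.tsum_eq_zero.2 hk
        _ ≤ _ := bot_le
    · rw [ENNReal.top_mul hα0, ENNReal.top_mul hH]
      exact le_top
  rcases eq_or_ne t 0 with rfl | ht0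
  · have : A = ∅ := eq_empty_iff_forall_notMem.2 fun x hx => not_lt_bot (hA x hx)
    simp [this]
  set C : ℝ≥0∞ := t * unitBallVolume m with hC
  have hC0 : C ≠ 0 := mul_ne_zero ht0 hα0
  have hCtop : C ≠ ⊤ := ENNReal.mul_ne_top httop hαtop
  -- the pieces
  let An : ℕ → Set V := fun n => {x ∈ A | ∀ r : ℝ, 0 < r → r < 1 / ((n : ℝ) + 1) →
    μ (closedBall x r) ≤ C * ENNReal.ofReal (r ^ m)}
  have hmono : Monotone An := by
    intro a b hab x hx
    refine ⟨hx.1, fun r hr hrb => hx.2 r hr (hrb.trans_le ?_)⟩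
    gcongr
  have hUnion : (⋃ n, An n) = A := by
    refine Subset.antisymm (iUnion_subset fun n x hx => hx.1) fun x hx => ?_
    have h1 : ∀ᶠ r in 𝓝[>] (0 : ℝ),
        μ (closedBall x r) / (unitBallVolume m * ENNReal.ofReal (r ^ m)) < t :=
      eventually_lt_of_limsup_lt (hA x hx)
    obtain ⟨ε, hε, hεr⟩ : ∃ ε > 0, ∀ r : ℝ, 0 < r → r < ε →
        μ (closedBall x r) / (unitBallVolume m * ENNReal.ofReal (r ^ m)) < t := by
      rcases (nhdsGT_basis (0 : ℝ)).eventually_iff.1 h1 with ⟨ε, hε, h⟩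
      exact ⟨ε, by simpa using hε, fun r hr hrε => h ⟨hr, hrε⟩⟩
    obtain ⟨n, hn⟩ := exists_nat_one_div_lt hε
    refine mem_iUnion.2 ⟨n, hx, fun r hr hrn => ?_⟩
    have h2 := hεr r hr (hrn.trans hn)
    have hb0 : unitBallVolume m * ENNReal.ofReal (r ^ m) ≠ 0 :=
      mul_ne_zero hα0 (ENNReal.ofReal_pos.2 (pow_pos hr m)).ne'
    have hbtop : unitBallVolume m * ENNReal.ofReal (r ^ m) ≠ ⊤ :=
      ENNReal.mul_ne_top hαtop ENNReal.ofReal_ne_top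
    have h3 := ((ENNReal.div_lt_iff (Or.inl hb0) (Or.inl hbtop)).1 h2).le
    calc μ (closedBall x r) ≤ t * (unitBallVolume m * ENNReal.ofReal (r ^ m)) := h3
      _ = C * ENNReal.ofReal (r ^ m) := by rw [hC, mul_assoc]
  -- each piece: `C⁻¹ μ ⌞ An n ≤ μH[m]`
  have hpiece : ∀ n, μ (An n) ≤ C * μH[m] (An n) := by
    intro n
    set ν : OuterMeasure V := C⁻¹ • OuterMeasure.restrict (An n) μ.toOuterMeasure with hν
    have hνapp : ∀ s, ν s = C⁻¹ * μ (s ∩ An n) := fun s => by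
      simp [hν, OuterMeasure.restrict_apply]
    have hδ : (0 : ℝ≥0∞) < ENNReal.ofReal (1 / (2 * ((n : ℝ) + 1))) :=
      ENNReal.ofReal_pos.2 (by positivity)
    have hle : ν ≤ OuterMeasure.mkMetric fun r => r ^ (m : ℝ) := by
      refine OuterMeasure.le_mkMetric _ ν _ hδ fun s hs => ?_
      rw [hνapp]
      rcases (s ∩ An n).eq_empty_or_nonempty with h0 | ⟨x, hxs, hxA⟩
      · rw [h0, measure_empty, mul_zero]
        exact bot_le
      have hstop : Metric.ediam s ≠ ⊤ := (hs.trans_lt ENNReal.ofReal_lt_top).ne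
      set R : ℝ := (Metric.ediam s).toReal with hR
      have hR0 : 0 ≤ R := ENNReal.toReal_nonneg
      have hRle : R ≤ 1 / (2 * ((n : ℝ) + 1)) := by
        rw [hR, ← ENNReal.toReal_ofReal (by positivity : (0 : ℝ) ≤ 1 / (2 * ((n : ℝ) + 1)))]
        exact ENNReal.toReal_mono ENNReal.ofReal_ne_top hs
      -- `μ (s ∩ An n) ≤ C (max R ρ)^m` for all small `ρ > 0`, then `ρ → 0`
      have hbound : ∀ ρ : ℝ, 0 < ρ → ρ < 1 / (2 * ((n : ℝ) + 1)) →
          μ (s ∩ An n) ≤ C * ENNReal.ofReal ((max R ρ) ^ m) := by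
        intro ρ hρ hρn
        have hsub : s ∩ An n ⊆ closedBall x (max R ρ) := fun y hy => by
          rw [mem_closedBall]
          refine le_trans ?_ (le_max_left _ _)
          rw [hR, ← ENNReal.toReal_ofReal dist_nonneg, ← edist_dist]
          exact ENNReal.toReal_mono hstop (Metric.edist_le_ediam_of_mem hy.1 hxs)
        refine (measure_mono hsub).trans (hxA.2 _ (lt_max_of_lt_right hρ) ?_)
        refine max_lt (hRle.trans_lt ?_) (hρn.trans ?_) <;>
          exact one_div_lt_one_div_of_lt (by positivity) (by linarith)
      have htend : Tendsto (fun ρ : ℝ => C * ENNReal.ofReal ((max R ρ) ^ m)) (𝓝[>] 0)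
          (𝓝 (C * ENNReal.ofReal ((max R 0) ^ m))) := by
        refine ENNReal.Tendsto.const_mul ?_ (Or.inr hCtop)
        exact ((ENNReal.continuous_ofReal.tendsto _).comp
          (((continuous_const.max continuous_id).pow m).tendsto 0)).mono_left nhdsWithin_le_nhds
      rw [max_eq_left hR0] at htend
      have hlim : μ (s ∩ An n) ≤ C * ENNReal.ofReal (R ^ m) :=
        ge_of_tendsto htend (by
          filter_upwards [Ioo_mem_nhdsGT (show (0 : ℝ) < 1 / (2 * ((n : ℝ) + 1)) by positivity)]
            with ρ hρ using hbound ρ hρ.1 hρ.2)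
      calc C⁻¹ * μ (s ∩ An n) ≤ C⁻¹ * (C * ENNReal.ofReal (R ^ m)) := by gcongr
        _ = ENNReal.ofReal (R ^ m) := by rw [← mul_assoc, ENNReal.inv_mul_cancel hC0 hCtop, one_mul]
        _ = Metric.ediam s ^ (m : ℝ) := by
            rw [ENNReal.rpow_natCast, ENNReal.ofReal_pow hR0, hR, ENNReal.ofReal_toReal hstop]
    have h1 : ν (An n) ≤ μH[m] (An n) := by
      have := hle (An n)
      rwa [OuterMeasure.coe_mkMetric] at this
    rw [hνapp, inter_self] at h1
    calc μ (An n) = C * (C⁻¹ * μ (An n)) := by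
          rw [← mul_assoc, ENNReal.mul_inv_cancel hC0 hCtop, one_mul]
      _ ≤ C * μH[m] (An n) := by gcongr
  -- continuity from below
  calc μ A = μ (⋃ n, An n) := by rw [hUnion]
    _ = ⨆ n, μ (An n) := hmono.measure_iUnion
    _ ≤ ⨆ n, C * μH[m] (An n) := iSup_mono hpiece
    _ ≤ C * μH[m] A := iSup_le fun n => by gcongr; exact fun x hx => hx.1

omit [NormedSpace ℝ V] in
/-- **Federer 2.10.19 (2), lower density bound**: if `μH[m](A) < ∞` (`A` measurable) and
`t · α(m) < 1`, then `{x ∈ A : Θ^{*m}(μH[m] ⌞ A, x) < t}` is `μH[m]`-null: by (1),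
`μH[m](A') ≤ t α(m) μH[m](A')` for this set `A'`. (For the normalised measure `𝓗^m = μHE[m]`
the threshold is the corresponding positive constant; Federer's sharp `2^{-m}` needs the value
of Mathlib's normalising factor.) [cite: Federer1969, 2.10.19 (2)] -/
theorem hausdorffMeasure_null_setOf_upperDensity_lt {A : Set V} (hAm : MeasurableSet A)
    (hA : μH[m] A ≠ ⊤) {t : ℝ≥0∞} (ht : t * unitBallVolume m < 1) :
    μH[m] {x ∈ A | upperDensity m ((μH[m] : Measure V).restrict A) x < t} = 0 := by
  have h1 := measure_le_of_upperDensity_lt ((μH[m] : Measure V).restrict A) m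
    (A := {x ∈ A | upperDensity m ((μH[m] : Measure V).restrict A) x < t}) fun x hx => hx.2
  rw [Measure.restrict_apply' hAm, inter_eq_left.2 (fun x hx => hx.1)] at h1
  have hfin : μH[m] {x ∈ A | upperDensity m ((μH[m] : Measure V).restrict A) x < t} ≠ ⊤ :=
    ne_top_of_le_ne_top hA (measure_mono fun x hx => hx.1)
  by_contra h0
  have h2 : μH[m] {x ∈ A | upperDensity m ((μH[m] : Measure V).restrict A) x < t} *
      (t * unitBallVolume m) <
        μH[m] {x ∈ A | upperDensity m ((μH[m] : Measure V).restrict A) x < t} * 1 :=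
    ENNReal.mul_lt_mul_right h0 hfin ht
  rw [mul_one, mul_comm] at h2
  exact absurd (h1.trans_lt h2) (lt_irrefl _)

omit [NormedSpace ℝ V] in
/-- **Lower density bound, a.e. form**: if `μH[m](A) < ∞` then for every `t < α(m)⁻¹`,
`Θ^{*m}(μH[m] ⌞ A, x) ≥ t` for `μH[m]`-a.e. `x ∈ A`. [cite: Federer1969, 2.10.19 (2)] -/
theorem ae_le_upperDensity_hausdorffMeasure_restrict {A : Set V} (hAm : MeasurableSet A)
    (hA : μH[m] A ≠ ⊤) {t : ℝ≥0∞} (ht : t < (unitBallVolume m)⁻¹) :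
    ∀ᵐ x ∂((μH[m] : Measure V).restrict A), t ≤ upperDensity m ((μH[m] : Measure V).restrict A) x := by
  have ht' : t * unitBallVolume m < 1 :=
    ENNReal.mul_lt_of_lt_div (by rwa [one_div])
  rw [ae_restrict_iff' hAm, ae_iff]
  have : {x | ¬(x ∈ A → t ≤ upperDensity m ((μH[m] : Measure V).restrict A) x)} =
      {x ∈ A | upperDensity m ((μH[m] : Measure V).restrict A) x < t} := by
    ext x; simp [not_le]
  rw [this]
  exact hausdorffMeasure_null_setOf_upperDensity_lt hAm hA ht'


end Literature.Geometry.GeometricMeasureTheory
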